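import Summits.Ventures.YMGap.Thresholds.OneLinkSDVariance
import Summits.Ventures.YMGap.Thresholds.OneLinkEigenCalculus
import Summits.QuantumFields.BalabanUV.InfraRed.StrongCouplingPoincareDoorSUN
import Summits.Ventures.YMGap.Thresholds.StarSUNRows
import HarnessLib

/-!
# Venture YMGap — the Poincaré × Schwinger–Dyson one-link modulus: a HYPOTHESIS-FREE inhabitant of the variance schema H2
# and the modulus `K_PV(N,R) = (NR/2 + √(1 + N²R²/4))/√(1/2 − R)` for every `SU(N)`, `N ≥ 2`, `R < 1/2`

HONEST FRAMING.  Venture file of the cell `pub-ymgap` (QuantumFields programme), seat engine-2 (g9); 0 compute.  Explicit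
STRONG-COUPLING constants for ONE tilted Haar law on `SU(N)` (small `β` bookkeeping for lattice Yang–Mills); NOT weak coupling,
NOT a continuum statement, NOT a Yang–Mills mass-gap claim.  Nothing new is estimated analytically: this file COMPOSES three theorems
already in the tree.

THE OBSERVATION.  Every all-`N` row of the cell passes through ONE constant, the one-link Kantorovich–Rubinstein modulus
`OneLinkKRModulus N R K` of the family `ν_B(dg) ∝ exp(N Re tr(g B)) dg`, `‖B‖_op ≤ R`.  pub-balaban's Poincaré–variance door
`StrongCouplingPoincareDoorSUN.oneLinkKRModulus_of_poincare_of_varianceBound` gives it as `K = √(c·v)` from a Poincaré constant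
`OneLinkPoincareSUN N R c` (needed for the ARBITRARY Lipschitz test function) and a variance bound `OneLinkVarianceBound N R v` for the
ONE linear observable `N Re tr(g Δ)`.  The cell's `SU(3)` column feeds this door with two CERTIFIED constants (H1 `c = 4/5` on `R ≤ 3/5`,
H2 `v = 49/20` on `R ≤ 11/30`, displayed as hypotheses).  Hypothesis-free, the tree had only Bakry–Émery for BOTH factors
(`c = 1/(N(1/2 − R))`, `v = N/(1/2 − R)`, product `K = 1/(1/2 − R)` = Shen–Zhu–Zhu).  But the variance factor does not need a
Poincaré inequality at all: p2's Schwinger–Dyson second moment `OneLinkSDVariance.sqrt_integral_normSq_trace_le_sd`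
(`E_{ν_B}|tr(gM)|² ≤ ‖M‖_F²(‖B‖_F/2 + √(‖B‖_F²/4 + 1/N))²`, valid for EVERY `B`, no radius cap) bounds it at the HAAR scale.  Hence:

* `oneLinkVarianceBound_sd` (K, every `N ≥ 1`, every `R`): `OneLinkVarianceBound N R (N·(NR/2 + √(1 + N²R²/4))²)` — a
  hypothesis-free inhabitant of H2's schema (`SU(3)` at `R = 11/30`: `v = 8.59` against Bakry–Émery's `22.5`; the certified H2 reads
  `2.45`; Haar value `3/2`);
* `oneLinkKRModulus_pv` (K, every `N ≥ 2`, `0 ≤ R < 1/2`): `OneLinkKRModulus N R ((NR/2 + √(1 + N²R²/4))/√(1/2 − R))` — Bakry–Émery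
  for the test function, Schwinger–Dyson for the linear observable;
* `oneLinkKRModulus_pv_of_le`: the same with rational majorants (`q² ≥ 1 + N²R²/4`, `p²(1/2 − R) ≥ 1`, `K ≥ (NR/2 + q)·p`), the
  shape the row files consume; `SU(3)` instances `su3_oneLinkKRModulus_pv_*` at the radii of the cell's doors.

WHAT IT BUYS (float comparison, `N = 3`; the rows are separate files): `K_PV(3,R)` against the best hypothesis-free modulus in the
tree `min(K_BE, K₁, K₂ᴮ)` (`StrongCouplingKernelWindow.oneLinkKRModulus_SU`, `OneLinkEigen.oneLinkKRModulus_eigen`,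
`OneLinkEigen.oneLinkKRModulus_levelTwoB`): `R = 0.2`: `2.454` vs `2.744`; `0.25`: `2.886` vs `4.000`; `0.3`: `3.458` vs `5.000`;
`11/30`: `4.632` vs `7.500` (crossover `R ≈ 0.175`; below it p2's level-two moduli are better, and for `N ≥ 5` at the star radii they
stay better — this is a SMALL-`N`, mid-radius lever).  Door thresholds for `SU(3)` at `ε → 0`: area law `R·K < 1` `d = 4`:
`β_W < 0.442` (was `3/8`), `d = 3`: `0.663` (was `9/16`); star doors `d = 4`: `0.318` (was `0.298`), `d = 3`: `0.488` (was `0.454`);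
`ImprovedThreshold 4 3`: `7/200` (was `4/125`).  NOT CLAIMED: anything for `SU(2)` (the quarter modulus `K = 1` is better), any
improvement of the CERTIFIED `SU(3)` column (`K = 7/5`), sharpness of `K_PV` (the cell's two-engine certificates give `7/5` at `R = 11/30`, a factor `3.3` below `K_PV` there).

References: H. Shen, R. Zhu, X. Zhu, CMP 400 (2023) 805–851 (arXiv:2204.12737), Lemma 4.1, Rem. 1.3 (Bakry–Émery on `SU(N)`);
H. Föllmer, LNM 1362 (1988) Thm. (2.13) (the covariance form behind `√(c·v)`); cell notes `HOME/p2/ONE-LINK-HIERARCHY.md` §4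
(Schwinger–Dyson second moments), `HOME/pub-ymgap-engine-2/HANDOFF-engine2-g9.md`.
-/

noncomputable section

open scoped Matrix ComplexConjugate BigOperators Matrix.Norms.Frobenius
open Matrix Complex MeasureTheory ProbabilityTheory
open Literature.MathematicalPhysics.QuantumFieldTheory
open Literature.MathematicalPhysics.QuantumFieldTheory.SUNBakryEmery
open Literature.MathematicalPhysics.QuantumFieldTheory.Balaban1983to89.StrongCouplingDobrushinWindow (OneLinkKRModulus)
open Summit.QuantumFields.BalabanUV.InfraRed.StrongCouplingVarianceDoorSUN (OneLinkVarianceBound)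
open Summit.QuantumFields.BalabanUV.InfraRed.StrongCouplingPoincareDoorSUN
  (OneLinkPoincareSUN oneLinkPoincareSUN_bakryEmery oneLinkKRModulus_of_poincare_of_varianceBound)
open Summit.Ventures.YMGap.OneLinkEigen (sqrt_integral_normSq_trace_le_sd frobNorm_le_sqrt_mul_matrixOpNorm)
open Summit.Ventures.YMGap.StarSUN (oneLinkKRModulus_mono_const)

namespace Summit.Ventures.YMGap.OneLinkVarianceSD

variable {N : ℕ}

/-! ### 1. The Schwinger–Dyson inhabitant of the variance schema -/

/-- Square-root bookkeeping: for `0 ≤ b ≤ √N·R`, `N² (b/2 + √(b²/4 + 1/N))² ≤ N (NR/2 + √(1 + N²R²/4))²`. [folklore] -/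
theorem sd_scale_le (hN : 1 ≤ N) {b R : ℝ} (hb0 : 0 ≤ b) (hb : b ≤ Real.sqrt N * R) :
    (N : ℝ) ^ 2 * (b / 2 + Real.sqrt (b ^ 2 / 4 + 1 / N)) ^ 2 ≤
      (N : ℝ) * ((N : ℝ) * R / 2 + Real.sqrt (1 + (N : ℝ) ^ 2 * R ^ 2 / 4)) ^ 2 := by
  have hNpos : (0 : ℝ) < N := by exact_mod_cast (show 0 < N by omega)
  have hsN : 0 ≤ Real.sqrt N := Real.sqrt_nonneg _
  have hsNsq : Real.sqrt N * Real.sqrt N = N := Real.mul_self_sqrt hNpos.le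
  -- `√N · (b/2 + √(b²/4 + 1/N)) ≤ NR/2 + √(1 + N²R²/4)`
  have h1 : Real.sqrt N * (b / 2) ≤ (N : ℝ) * R / 2 := by
    have := mul_le_mul_of_nonneg_left hb hsN
    rw [← mul_assoc, hsNsq] at this
    linarith
  have hb2 : b ^ 2 ≤ (N : ℝ) * R ^ 2 := by
    have h := pow_le_pow_left₀ hb0 hb 2
    rw [mul_pow, Real.sq_sqrt hNpos.le] at h
    exact h
  have h2 : Real.sqrt N * Real.sqrt (b ^ 2 / 4 + 1 / N) ≤ Real.sqrt (1 + (N : ℝ) ^ 2 * R ^ 2 / 4) := by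
    rw [← Real.sqrt_mul hNpos.le]
    apply Real.sqrt_le_sqrt
    have e : (N : ℝ) * (b ^ 2 / 4 + 1 / N) = (N : ℝ) * b ^ 2 / 4 + 1 := by
      field_simp
    rw [e]
    nlinarith [mul_le_mul_of_nonneg_left hb2 hNpos.le]
  have h3 : Real.sqrt N * (b / 2 + Real.sqrt (b ^ 2 / 4 + 1 / N)) ≤
      (N : ℝ) * R / 2 + Real.sqrt (1 + (N : ℝ) ^ 2 * R ^ 2 / 4) := by
    rw [mul_add]; exact add_le_add h1 h2
  have hL0 : 0 ≤ Real.sqrt N * (b / 2 + Real.sqrt (b ^ 2 / 4 + 1 / N)) := by positivity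
  have h4 := pow_le_pow_left₀ hL0 h3 2
  calc (N : ℝ) ^ 2 * (b / 2 + Real.sqrt (b ^ 2 / 4 + 1 / N)) ^ 2
      = (N : ℝ) * (Real.sqrt N * (b / 2 + Real.sqrt (b ^ 2 / 4 + 1 / N))) ^ 2 := by
        rw [mul_pow, Real.sq_sqrt hNpos.le]; ring
    _ ≤ (N : ℝ) * ((N : ℝ) * R / 2 + Real.sqrt (1 + (N : ℝ) ^ 2 * R ^ 2 / 4)) ^ 2 :=
        mul_le_mul_of_nonneg_left h4 hNpos.le

/-- **The Schwinger–Dyson inhabitant of the variance schema, every `SU(N)`, `N ≥ 1`, every radius, HYPOTHESIS-FREE**: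
`OneLinkVarianceBound N R (N·(NR/2 + √(1 + N²R²/4))²)`, i.e. for `‖B‖_op ≤ R` and every `Δ`,
`Var_{ν_B}(N Re tr(g Δ)) ≤ N (NR/2 + √(1 + N²R²/4))² ‖Δ‖_F²`.  Proof: `Var ≤ E(·)²`, `(Re z)² ≤ |z|²`, p2's Schwinger–Dyson second
moment `E_{ν_B}|tr(gΔ)|² ≤ ‖Δ‖_F²(‖B‖_F/2 + √(‖B‖_F²/4 + 1/N))²` (no hypothesis on `B`), and `‖B‖_F ≤ √N‖B‖_op`. [folklore] -/
theorem oneLinkVarianceBound_sd (hN : 1 ≤ N) (R : ℝ) :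
    OneLinkVarianceBound N R ((N : ℝ) * ((N : ℝ) * R / 2 + Real.sqrt (1 + (N : ℝ) ^ 2 * R ^ 2 / 4)) ^ 2) := by
  intro B hB Δ
  have hN0 : N ≠ 0 := by omega
  have hNpos : (0 : ℝ) < N := by exact_mod_cast (show 0 < N by omega)
  set ν : Measure (SUN N) := (haarProbability (SUN N)).tilted
      (fun g => (N : ℝ) * ((g : Matrix (Fin N) (Fin N) ℂ) * B).trace.re) with hν
  have hexpi : Integrable (fun g : SUN N => Real.exp ((N : ℝ) * ((g : Matrix (Fin N) (Fin N) ℂ) * B).trace.re))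
      (haarProbability (SUN N)) :=
    integrable_of_continuous_SUN (Real.continuous_exp.comp (continuous_restrict (contDiff_pot (N : ℝ) B))) _
  haveI : IsProbabilityMeasure ν := isProbabilityMeasure_tilted hexpi
  -- the observable and the complex statistic
  have htr : Continuous fun g : SUN N => ((g : Matrix (Fin N) (Fin N) ℂ) * Δ).trace :=
    (continuous_subtype_val.matrix_mul continuous_const).matrix_trace
  set X : SUN N → ℝ := fun g => (N : ℝ) * ((g : Matrix (Fin N) (Fin N) ℂ) * Δ).trace.re with hX
  have hXc : Continuous X := continuous_const.mul (Complex.continuous_re.comp htr)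
  have hzc : Continuous fun g : SUN N => ‖((g : Matrix (Fin N) (Fin N) ℂ) * Δ).trace‖ ^ 2 :=
    (continuous_norm.comp htr).pow 2
  -- (1) `Var ≤ E X²`
  have h1 : Var[X; ν] ≤ ∫ g, X g ^ 2 ∂ν := by
    have h := variance_le_expectation_sq (μ := ν) hXc.aestronglyMeasurable
    simpa only [Pi.pow_apply] using h
  -- (2) `E X² ≤ N² E|tr(gΔ)|²`
  have h2 : ∫ g, X g ^ 2 ∂ν ≤ (N : ℝ) ^ 2 * ∫ g, ‖((g : Matrix (Fin N) (Fin N) ℂ) * Δ).trace‖ ^ 2 ∂ν := by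
    rw [← integral_const_mul]
    refine integral_mono_of_nonneg (ae_of_all _ fun g => sq_nonneg _)
      ((integrable_of_continuous_SUN hzc ν).const_mul _) (ae_of_all _ fun g => ?_)
    have hre : |((g : Matrix (Fin N) (Fin N) ℂ) * Δ).trace.re| ≤ ‖((g : Matrix (Fin N) (Fin N) ℂ) * Δ).trace‖ :=
      Complex.abs_re_le_norm _
    have hsq : ((g : Matrix (Fin N) (Fin N) ℂ) * Δ).trace.re ^ 2 ≤ ‖((g : Matrix (Fin N) (Fin N) ℂ) * Δ).trace‖ ^ 2 := by
      have := sq_le_sq' (abs_le.1 hre).1 (abs_le.1 hre).2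
      simpa using this
    show ((N : ℝ) * ((g : Matrix (Fin N) (Fin N) ℂ) * Δ).trace.re) ^ 2 ≤
      (N : ℝ) ^ 2 * ‖((g : Matrix (Fin N) (Fin N) ℂ) * Δ).trace‖ ^ 2
    rw [mul_pow]
    exact mul_le_mul_of_nonneg_left hsq (sq_nonneg _)
  -- (3) the Schwinger–Dyson second moment, squared
  set S : ℝ := ∫ g, ‖((g : Matrix (Fin N) (Fin N) ℂ) * Δ).trace‖ ^ 2 ∂ν with hS
  have hS0 : 0 ≤ S := integral_nonneg fun g => sq_nonneg _
  have hsd := sqrt_integral_normSq_trace_le_sd hN0 B Δ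
  have hT0 : 0 ≤ frobNorm Δ * (frobNorm B / 2 + Real.sqrt (frobNorm B ^ 2 / 4 + 1 / N)) := by
    have := frobNorm_nonneg Δ
    have := frobNorm_nonneg B
    positivity
  have h3 : S ≤ (frobNorm Δ * (frobNorm B / 2 + Real.sqrt (frobNorm B ^ 2 / 4 + 1 / N))) ^ 2 := by
    have h := pow_le_pow_left₀ (Real.sqrt_nonneg S) hsd 2
    rwa [Real.sq_sqrt hS0] at h
  -- (4) `‖B‖_F ≤ √N R` and the scale bookkeeping
  have hb : frobNorm B ≤ Real.sqrt N * R :=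
    (frobNorm_le_sqrt_mul_matrixOpNorm B).trans (mul_le_mul_of_nonneg_left hB (Real.sqrt_nonneg _))
  have h4 := sd_scale_le hN (frobNorm_nonneg B) hb
  calc Var[X; ν] ≤ ∫ g, X g ^ 2 ∂ν := h1
    _ ≤ (N : ℝ) ^ 2 * S := h2
    _ ≤ (N : ℝ) ^ 2 * (frobNorm Δ * (frobNorm B / 2 + Real.sqrt (frobNorm B ^ 2 / 4 + 1 / N))) ^ 2 :=
        mul_le_mul_of_nonneg_left h3 (sq_nonneg _)
    _ = (N : ℝ) ^ 2 * (frobNorm B / 2 + Real.sqrt (frobNorm B ^ 2 / 4 + 1 / N)) ^ 2 * frobNorm Δ ^ 2 := by ring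
    _ ≤ (N : ℝ) * ((N : ℝ) * R / 2 + Real.sqrt (1 + (N : ℝ) ^ 2 * R ^ 2 / 4)) ^ 2 * frobNorm Δ ^ 2 :=
        mul_le_mul_of_nonneg_right h4 (sq_nonneg _)

/-! ### 2. The Poincaré × Schwinger–Dyson modulus -/

/-- The algebra of the door `√(c·v)` with Bakry–Émery's `c = 1/(N(1/2 − R))` and the Schwinger–Dyson
`v = N·A²`, `A = NR/2 + √(1 + N²R²/4)`: `√(c·v) = A/√(1/2 − R)`. [folklore] -/
theorem sqrt_bakryEmery_mul_sd_eq (hN : 1 ≤ N) {R : ℝ} (hR0 : 0 ≤ R) (hR : R < 1 / 2) :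
    Real.sqrt (1 / ((N : ℝ) * (1 / 2 - R)) *
        ((N : ℝ) * ((N : ℝ) * R / 2 + Real.sqrt (1 + (N : ℝ) ^ 2 * R ^ 2 / 4)) ^ 2)) =
      ((N : ℝ) * R / 2 + Real.sqrt (1 + (N : ℝ) ^ 2 * R ^ 2 / 4)) / Real.sqrt (1 / 2 - R) := by
  have hNpos : (0 : ℝ) < N := by exact_mod_cast (show 0 < N by omega)
  have h12 : 0 < 1 / 2 - R := by linarith
  set A : ℝ := (N : ℝ) * R / 2 + Real.sqrt (1 + (N : ℝ) ^ 2 * R ^ 2 / 4) with hA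
  have hA0 : 0 ≤ A := by positivity
  have e1 : 1 / ((N : ℝ) * (1 / 2 - R)) * ((N : ℝ) * A ^ 2) = A ^ 2 / (1 / 2 - R) := by
    field_simp
  rw [e1, Real.sqrt_div (sq_nonneg A), Real.sqrt_sq hA0]

/-- **Rational envelope of the constant**: for `0 ≤ R < 1/2` and `q, p ≥ 0` with `q² ≥ 1 + N²R²/4`, `p²(1/2 − R) ≥ 1`:
`(NR/2 + √(1 + N²R²/4))/√(1/2 − R) ≤ (NR/2 + q)·p`. [folklore] -/
theorem pv_le_of_le {R q p : ℝ} (hR0 : 0 ≤ R) (hR : R < 1 / 2) (hq0 : 0 ≤ q)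
    (hq : 1 + (N : ℝ) ^ 2 * R ^ 2 / 4 ≤ q ^ 2) (hp0 : 0 ≤ p) (hp : 1 ≤ p ^ 2 * (1 / 2 - R)) :
    ((N : ℝ) * R / 2 + Real.sqrt (1 + (N : ℝ) ^ 2 * R ^ 2 / 4)) / Real.sqrt (1 / 2 - R) ≤ ((N : ℝ) * R / 2 + q) * p := by
  have hNnn : (0 : ℝ) ≤ N := Nat.cast_nonneg N
  have h12 : 0 < 1 / 2 - R := by linarith
  have hs0 : 0 < Real.sqrt (1 / 2 - R) := Real.sqrt_pos.2 h12
  have h1 : Real.sqrt (1 + (N : ℝ) ^ 2 * R ^ 2 / 4) ≤ q := by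
    rw [← Real.sqrt_sq hq0]; exact Real.sqrt_le_sqrt hq
  have h2 : 1 ≤ p * Real.sqrt (1 / 2 - R) := by
    have e : p * Real.sqrt (1 / 2 - R) = Real.sqrt (p ^ 2 * (1 / 2 - R)) := by
      rw [Real.sqrt_mul (sq_nonneg p), Real.sqrt_sq hp0]
    rw [e]
    calc (1 : ℝ) = Real.sqrt 1 := Real.sqrt_one.symm
      _ ≤ Real.sqrt (p ^ 2 * (1 / 2 - R)) := Real.sqrt_le_sqrt hp
  rw [div_le_iff₀ hs0]
  have hA0 : 0 ≤ (N : ℝ) * R / 2 + q := by positivity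
  calc (N : ℝ) * R / 2 + Real.sqrt (1 + (N : ℝ) ^ 2 * R ^ 2 / 4) ≤ ((N : ℝ) * R / 2 + q) * 1 := by linarith
    _ ≤ ((N : ℝ) * R / 2 + q) * (p * Real.sqrt (1 / 2 - R)) := mul_le_mul_of_nonneg_left h2 hA0
    _ = ((N : ℝ) * R / 2 + q) * p * Real.sqrt (1 / 2 - R) := by ring

/-- **THE POINCARÉ × SCHWINGER–DYSON ONE-LINK MODULUS, EVERY `SU(N)`, `N ≥ 2`, HYPOTHESIS-FREE**: for `0 ≤ R < 1/2`,
`OneLinkKRModulus N R ((NR/2 + √(1 + N²R²/4))/√(1/2 − R))` — the Poincaré–variance door `√(c·v)` with Bakry–Émery's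
`c = 1/(N(1/2 − R))` (test function) and the Schwinger–Dyson `v = N(NR/2 + √(1 + N²R²/4))²` (linear observable).
[cite: arXiv220412737, Lemma 4.1 and Rem. 1.3] -/
theorem oneLinkKRModulus_pv (hN : 2 ≤ N) {R : ℝ} (hR0 : 0 ≤ R) (hR : R < 1 / 2) :
    OneLinkKRModulus N R
      (((N : ℝ) * R / 2 + Real.sqrt (1 + (N : ℝ) ^ 2 * R ^ 2 / 4)) / Real.sqrt (1 / 2 - R)) := by
  have hNpos : (0 : ℝ) < N := by exact_mod_cast (show 0 < N by omega)
  have h12 : 0 < 1 / 2 - R := by linarith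
  have hP := oneLinkPoincareSUN_bakryEmery hN hR
  have hV := oneLinkVarianceBound_sd (N := N) (by omega) R
  have hc0 : 0 ≤ 1 / ((N : ℝ) * (1 / 2 - R)) := by positivity
  have hv0 : 0 ≤ (N : ℝ) * ((N : ℝ) * R / 2 + Real.sqrt (1 + (N : ℝ) ^ 2 * R ^ 2 / 4)) ^ 2 := by positivity
  have h := oneLinkKRModulus_of_poincare_of_varianceBound hc0 hv0 hP hV
  rw [sqrt_bakryEmery_mul_sd_eq (by omega) hR0 hR] at h
  exact h

/-- **Rational envelope** (the shape the row files consume): for `N ≥ 2`, `0 ≤ R < 1/2` and rationals `q, p ≥ 0` with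
`q² ≥ 1 + N²R²/4`, `p²(1/2 − R) ≥ 1`, every `K ≥ (NR/2 + q)·p` is a one-link modulus on the ball of radius `R`. [folklore] -/
theorem oneLinkKRModulus_pv_of_le (hN : 2 ≤ N) {R q p K : ℝ} (hR0 : 0 ≤ R) (hR : R < 1 / 2) (hq0 : 0 ≤ q)
    (hq : 1 + (N : ℝ) ^ 2 * R ^ 2 / 4 ≤ q ^ 2) (hp0 : 0 ≤ p) (hp : 1 ≤ p ^ 2 * (1 / 2 - R))
    (hK : ((N : ℝ) * R / 2 + q) * p ≤ K) : OneLinkKRModulus N R K :=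
  oneLinkKRModulus_mono_const (oneLinkKRModulus_pv hN hR0 hR) ((pv_le_of_le hR0 hR hq0 hq hp0 hp).trans hK)

/-! ### 3. `SU(3)` forms with literal constants (the shapes the cell's `SU(3)` row files consume) -/

/-- `SU(3)`: Bakry–Émery's Poincaré constant `1/(3(1/2 − R))` on `R < 1/2`, literal form. [folklore] -/
theorem su3_oneLinkPoincare_bakryEmery {R : ℝ} (hR : R < 1 / 2) : OneLinkPoincareSUN 3 R (1 / (3 * (1 / 2 - R))) := by
  have h := oneLinkPoincareSUN_bakryEmery (N := 3) (by norm_num) hR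
  norm_num at h ⊢
  exact h

/-- `SU(3)`: the Schwinger–Dyson variance bound `3·(3R/2 + √(1 + 9R²/4))²`, every `R`, literal form — the hypothesis-free
counterpart of the cell's certified H2 `OneLinkVarianceBound 3 (11/30) (49/20)` (at `R = 11/30` it reads `8.59`). [folklore] -/
theorem su3_oneLinkVarianceBound_sd (R : ℝ) :
    OneLinkVarianceBound 3 R (3 * (3 * R / 2 + Real.sqrt (1 + 9 * R ^ 2 / 4)) ^ 2) := by
  have h := oneLinkVarianceBound_sd (N := 3) (by norm_num) R
  have e : (1 : ℝ) + ((3 : ℕ) : ℝ) ^ 2 * R ^ 2 / 4 = 1 + 9 * R ^ 2 / 4 := by norm_num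
  rw [e] at h
  norm_num at h ⊢
  exact h

/-- `SU(3)`: the door constant `√(c·v)` of the pair `(1/(3(1/2 − R)), 3(3R/2 + √(1 + 9R²/4))²)` is at most `(3R/2 + q)·p` for
rationals `q² ≥ 1 + 9R²/4`, `p²(1/2 − R) ≥ 1` (`q, p ≥ 0`, `0 ≤ R < 1/2`). [folklore] -/
theorem su3_sqrt_cv_le {R q p : ℝ} (hR0 : 0 ≤ R) (hR : R < 1 / 2) (hq0 : 0 ≤ q) (hq : 1 + 9 * R ^ 2 / 4 ≤ q ^ 2)
    (hp0 : 0 ≤ p) (hp : 1 ≤ p ^ 2 * (1 / 2 - R)) :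
    Real.sqrt (1 / (3 * (1 / 2 - R)) * (3 * (3 * R / 2 + Real.sqrt (1 + 9 * R ^ 2 / 4)) ^ 2)) ≤ (3 * R / 2 + q) * p := by
  have e := sqrt_bakryEmery_mul_sd_eq (N := 3) (by norm_num) hR0 hR
  have h := pv_le_of_le (N := 3) hR0 hR hq0 (by norm_num; linarith) hp0 hp
  have e9 : (1 : ℝ) + ((3 : ℕ) : ℝ) ^ 2 * R ^ 2 / 4 = 1 + 9 * R ^ 2 / 4 := by norm_num
  rw [e9] at e h
  norm_num at e h ⊢
  rw [e]
  linarith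

/-- `SU(3)`: the square root of Bakry–Émery's constant, `√(1/(3(1/2 − R))) ≤ s₀` for rational `s₀ ≥ 0` with
`3 s₀²(1/2 − R) ≥ 1`. [folklore] -/
theorem su3_sqrt_c_le {R s₀ : ℝ} (hR : R < 1 / 2) (hs0 : 0 ≤ s₀) (hs : 1 ≤ 3 * s₀ ^ 2 * (1 / 2 - R)) :
    Real.sqrt (1 / (3 * (1 / 2 - R))) ≤ s₀ := by
  have h12 : 0 < 3 * (1 / 2 - R) := by linarith
  rw [← Real.sqrt_sq hs0]
  apply Real.sqrt_le_sqrt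
  rw [div_le_iff₀ h12]
  linarith

/-- `SU(3)`: the Poincaré × Schwinger–Dyson modulus with a rational constant: `0 ≤ R < 1/2`, `q² ≥ 1 + 9R²/4`, `p²(1/2 − R) ≥ 1`,
`K ≥ (3R/2 + q)·p` ⇒ `OneLinkKRModulus 3 R K`. [folklore] -/
theorem su3_oneLinkKRModulus_pv_of_le {R q p K : ℝ} (hR0 : 0 ≤ R) (hR : R < 1 / 2) (hq0 : 0 ≤ q)
    (hq : 1 + 9 * R ^ 2 / 4 ≤ q ^ 2) (hp0 : 0 ≤ p) (hp : 1 ≤ p ^ 2 * (1 / 2 - R)) (hK : (3 * R / 2 + q) * p ≤ K) :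
    OneLinkKRModulus 3 R K := by
  refine oneLinkKRModulus_pv_of_le (N := 3) (by norm_num) hR0 hR hq0 (by norm_num; linarith) hp0 hp ?_
  norm_num
  exact hK

/-- `SU(3)`, radius `1/5` (Wilson `β_W = 3/10` at the `d = 4` star/slab radius `2β_W/3`): `OneLinkKRModulus 3 (1/5) (491/200)`
(`K_PV = 2.4539…`; certificate `q = 10441/10000`, `p = 18258/10000`) — against Bakry–Émery's `10/3` and p2's `K₁ = 27/8`.
[folklore] -/
theorem su3_oneLinkKRModulus_pv_oneFifth : OneLinkKRModulus 3 (1 / 5) (491 / 200) :=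
  su3_oneLinkKRModulus_pv_of_le (q := 10441 / 10000) (p := 18258 / 10000)
    (by norm_num) (by norm_num) (by norm_num) (by norm_num) (by norm_num) (by norm_num) (by norm_num)

/-- `SU(3)`, radius `11/30` (the cell's certificate radius; Wilson `β_W = 11/20` in `d = 4`, `33/40` in `d = 3`):
`OneLinkKRModulus 3 (11/30) (4633/1000)` hypothesis-free (`K_PV = 4.6317…`; `q = 114128/100000`, `p = 273862/100000`) — against
Bakry–Émery's `15/2`; the CERTIFIED constant there is `7/5` (H1 ∧ H2, not proved in the tree). [folklore] -/
theorem su3_oneLinkKRModulus_pv_elevenThirtieths : OneLinkKRModulus 3 (11 / 30) (4633 / 1000) :=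
  su3_oneLinkKRModulus_pv_of_le (q := 114128 / 100000) (p := 273862 / 100000)
    (by norm_num) (by norm_num) (by norm_num) (by norm_num) (by norm_num) (by norm_num) (by norm_num)

end Summit.Ventures.YMGap.OneLinkVarianceSD

end
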